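import Mathlib
import HarnessLib
import HarnessLib.Audit
import Summits.MatrixMultiplication.Statement
import Literature.Computability.AlgebraicComplexity.AsymptoticSpectrum
import HarnessLib.Audit.Status.Attr

/-!
Route: HessianPlane

DORMANT since 2026-08-25T03:31:25Z (reconciler: no traction for 7.3 d (last activity item-evidence-added at 2026-08-17T18:57:05Z); parked, not closed — `ledger route dormant route-MatrixMultiplication-HessianPlane --off` to reactivate) — unstaffed, not closed; items shared with open routes are served there. `ledger route dormant <id> --off` reactivates.

# Route HessianPlane — omega = 2 sits at two points of the Hessian plane — asymptotic rank is flat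
(≡ 3) on Nurmiev's Cartan subspace of 3×3×3 tensors

X_HES (Hessian-plane flatness; realises card hessian-plane-weighted-z3-tables). For (a,b,c) ∈ ℂ³ let
u(a,b,c) ∈ ℂ³⊗ℂ³⊗ℂ³ be the
translation-invariantly weighted ℤ/3 addition table u(a,b,c)(x,y,z) = [x+y+z ≡ 0]·w(y−x), w =
(a,b,c) — Nurmiev's semisimple normal form
a·X₁ + b·X₂ + c·X₃ (X₁ = Σe_iii, X₂ = Σe_{i,i+1,i+2}, X₃ = Σe_{i,i+2,i+1}; BremnerHuOeding2014 §4,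
Nurmiev2000, Vinberg1976): every tensor with
closed SL₃³-orbit is conjugate into this plane 𝔠, and every SL₃³-invariant quantity restricted to 𝔠
is invariant under the finite Weyl group
W ≅ G₂₅ (invariant degrees 6, 9, 12). It suffices to show: the asymptotic rank is FLAT on the plane
— for all (a,b,c) and every ε > 0,
R(u(a,b,c)^{⊠N}) = O(3^{(1+ε)N}) (i.e. R~(u) ≤ 3; = 3 off the origin). The summit follows from the
single point (a,b,c) = (0,1,1), where
u(0,1,1) = Σ_{σ∈S₃} e_σ = cw₂′ ≅ T_cw,2 over ℂ (AlmanLi2026 §7.1; route AsymptoticRankCW's target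
BThesis), by the PROVED asymptotic-rank form of
Coppersmith–Winograd 1990; the Levi-Civita point u(0,1,−1) = T_skewcw,2 is a second summit point
(ConnerGesmundoLandsbergVentura2022 Prop 2.2).
Lean: `∀ a b c : ℂ, ∀ ε : ℝ, 0 < ε → (fun N : ℕ =>
(Literature.Computability.AlgebraicComplexity.tensorRank
(Literature.Computability.AlgebraicComplexity.kroneckerPow (fun x y z : Fin 3 => if x + y + z = 0
then ![a, b, c] (y - x) else (0 : ℂ)) N) : ℝ)) =O[Filter.atTop] fun N : ℕ => (3 : ℝ) ^ ((1 + ε) *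
N)`

## Assembly
Pure logic plus one proved Literature fact: X_HES at (0,1,1) gives BThesis (HesseToCW: u(0,1,1) =
cw₂′ and T_cw,2 = ½(M⊗M⊗M)·cw₂′, rank is
GL³-invariant); BThesis gives ω(ℂ) ≤ 2 by `CoppersmithWinograd1990_asymptoticRank_form_holds 2
le_rfl 3 _` (the CW90 easy construction
with asymptotic rank in place of border rank, BurgisserClausenShokrollahi1997 Ex. 15.24, PROVED in
tree) and `logb_two_cw_two`; `omega_ge_two`
(Theorems/AsymptoticSpectrumOmegaGeTwo.lean) closes ω(ℂ) = 2. Equivalently Assembly =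
CWPointAssembly ∘ HesseToCW.

Rationale: WHY THIS LINE. Mechanism: replace the two isolated ω = 2 tensors of route AsymptoticRankCW (cw₂ with
bR 4, skew-cw₂ = ε₃ with bR 5) by ONE W-invariant
function ρ(a:b:c) = R~(u(a,b,c)) on the weighted projective plane P(𝔠)/W ≅ P(6,9,12): θ-group theory
(Vinberg1976: Jordan decomposition,
Cartan subspace, Weyl group; Nurmiev2000 normal forms; BremnerHuOeding2014: I₆, I₉, I₁₂ and Δ₃₃₃
restricted to 𝔠, whose 12 cubed linear factors
abc·Π(a+ωⁱb+ωʲc) are the mirrors of W) is imported as the organising symmetry, and semicontinuity of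
asymptotic rank (arXiv:2411.15789 Thm 1.2)
makes every sublevel set {ρ ≤ r} a W-stable Zariski-closed subset of P², so computations at a
generic point transfer along W-orbits and
specialise to the summit points. Verified free theorems (Sketch.lean rc 0 + exact arithmetic, this
session): u(0,1,1) = cw₂′ and u(0,1,−1) =
the Levi-Civita tensor of AsymptoticRankCW.BDet3AsymptoticRank literally; the support {x+y+z ≡ 0} is
free with uniform marginals for EVERY
(a,b,c) ≠ 0, so all quantum functionals equal 3 on the punctured plane (every known spectral lower
bound is blind there); W contains
C (a,b,c)↦(b,c,a), S (swap b,c = factor transposition), D (a,ωb,ω²c), D′ (a,ωb,ωc) and the Fourier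
element F (a,b,c)↦(a+b+c, a+ω²b+ωc,
a+ωb+ω²c); the unit locus {R = 3} is the 12 double points of the mirror arrangement (3 coordinate
points and the 9 points a³=b³=c³ — the card's
"character points" were only 3 of them), the Levi-Civita orbit is the 9 quadruple points, bR = 4
exactly on the 9 lines {I₉ = 0} =
W·(Hesse pencil aX₁ + b(X₂+X₃)) and bR = 5 elsewhere; Kronecker powers of plane points stay
polystable, so distinct W-orbits never degenerate
into each other (no monotonicity comes for free — the content is genuinely asymptotic). Correction
to the card: generic plane points are free
but NOT tight (ConnerGesmundoLandsbergVenturaWang2020 Thm 1.9: Tight₃ has codimension 2), so X_HES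
is the m = 3 case of the GENERAL concise
asymptotic rank conjecture (BurgisserClausenShokrollahi1997 Problem 15.5;
ConnerGesmundoLandsbergVenturaWang2020 §1: "ω = 2 would follow from the
m = 3 case of any of the generalizations"), by closedness + density of semisimple orbits equivalent
to ARC for all 3×3×3 tensors. What the line
adds to AsymptoticRankCW (whose BThesis and Assembly it shares by signature) and to the negatives
index (empty): plane-UNIFORM cruxes — a symbolic
CGLV Theorem* 2.13 over ℂ(a,b,c) (their Problem 2.14), the unit gap at degree 2, and the threshold
R~ ≤ 4 = bR(cw₂) for every semisimple
3×3×3 tensor — each decidable by finite algebra or refutable by one certified point, and each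
speaking about cw₂ and ε₃ simultaneously.

RANKED CRUXES. #0 HessianPlaneFlat (target) — for all (a,b,c) ∈ ℂ³ and ε > 0, R(u(a,b,c)^{⊠N}) =
O(3^{(1+ε)N}): asymptotic rank is ≤ 3 (hence = 3 off the origin) on the whole Hessian plane; card
item C1. (why it might fail: Equivalent to ARC for ALL 3×3×3 tensors (closedness + semisimple
density); generic points are free but not tight, bR 5, and nothing below 4.69 is known off the 12
unit points; one dark spectral point anywhere on the plane refutes it.)
[BurgisserClausenShokrollahi1997, ConnerGesmundoLandsbergVenturaWang2020, arXiv:2411.15789,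
Nurmiev2000, Vinberg1976, BremnerHuOeding2014, AlmanLi2026]
#2 HessianSquareBound (crux) — uniformly on the plane, the Kronecker square drops:
bR(u(a,b,c)⊠u(a,b,c)) ≤ 22 < 25 for ALL (a,b,c) — CGLV Theorem* 2.13 (numerical) made symbolic on 𝔠,
i.e. their Problem 2.14; by density of semisimple orbits and closedness of σ₂₂ this is the statement
for every 3×3×3 tensor. The plane makes a uniform proof conceivable: ONE border decomposition of
rank 22 over ℂ(a,b,c)[ε] (W-equivariance and the (ℤ/3)²-translation symmetry of u⊠u cut the search),
specialising to 16 at the cw₂-orbit and 17 at the Levi-Civita orbit. Card item C2 (degree-2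
border-rank map β₂). [difficulty: L] (why it might fail: CGLV's 22 is floating-point ALS at random
points (Thm* 2.13, ℓ₂-evidence only); the exact generic value may be 23–25, and a rank-22 scheme
over ℂ(a,b,c)[ε] may need a finite extension (monodromy of W) or not exist even if pointwise limits
do.) [ConnerGesmundoLandsbergVentura2022, ConnerGesmundoLandsbergVenturaWang2020,
ConnerHuangLandsberg2020, BremnerHuOeding2014]
#3 UnitGap (crux) — the degree-2 map detects units with a gap: if bR(u(a,b,c)⊠u(a,b,c)) ≤ 15 then
bR(u(a,b,c)) ≤ 3 (u is one of the 12 unit points or 0). Equivalently β₂ ≥ 16 = β₂(cw₂)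
(ConnerHuangLandsberg2020) at every non-unit point, so the CW orbit MINIMISES the square's border
rank among non-units (card check (β): "the summit points are the most unit-like semisimple
tensors"). Forced at generic points of bR 5 by semicontinuity of Koszul ranks from the Levi-Civita
point (square = det₃, Koszul 16, bR 17); the content is the 9 lines of border rank 4 = W·(Hesse
pencil of plane cubics aX₁+b(X₂+X₃)), where only 15 ≤ β₂ ≤ 16 is known for smooth members.
[difficulty: L] (why it might fail: A smooth Hesse cubic has bR 4, Koszul bound 15 and no
degeneration to cw₂ forcing 16; CGLV Prop 6.2 lists bR-4 tight 3×3×3 tensors with squares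
numerically ≤ 14 — if one of them, or one smooth cubic, is a plane point with square ≤ 15, false.)
[ConnerHuangLandsberg2020, ConnerGesmundoLandsbergVentura2022, ConnerHarperLandsberg2019,
BremnerHuOeding2014, Nurmiev2000]
#4 PlaneUniformFour (crux) — every point of the plane — hence every semisimple, hence (closedness)
every 3×3×3 tensor — has asymptotic rank ≤ 4 = bR(cw₂): for all (a,b,c), ε > 0, R(u(a,b,c)^{⊠N}) =
O(4^{(1+ε)N}). The first uniform threshold below the generic border rank 5 beyond the numerical √22
≈ 4.690 and Alman–Li's rigorous 3 + 2^{ω/3} < 4.7297 (Cor 4.1); by W-invariance and closedness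
equivalent to ρ ≤ 4 at one generic point. A way-point to X_HES that already says "no 3×3×3 tensor is
asymptotically more expensive than cw₂ is naively" (card: ρ-upper-bound function from W-equivariant
speed-ups). [deps: HessianSquareBound] [difficulty: open-problem] (why it might fail: Nothing below
3+2^{ω/3} < 4.7297 (AlmanLi2026 Cor 4.1) is proved at a generic point (bR 5; 22 only numerically;
the Kaski–Michałek census gets no improvement at format (3,3,3)); ρ_gen may exceed 4, which would
separate cw₂ from the generic tensor instead.) [AlmanLi2026, ConnerGesmundoLandsbergVentura2022,
arXiv:2601.08119, arXiv:2411.15789]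
#9 HesseToCW (support) — the CW point: X_HES → BThesis of route AsymptoticRankCW
(stmt-MatrixMultiplication-0588, body inlined). Proof: instance (a,b,c) = (0,1,1); u(0,1,1) = P :=
[x,y,z pairwise distinct] (Sketch.lean example, by decide), and T_cw,2 = ½·(M⊗M⊗M)·P with M =
[[1,0,0],[0,1,1],[0,i,−i]] (cubic forms 6x₀x₁x₂ ↦ 6x₀(x₁²+x₂²); verified exactly), so T_cw,2^{⊠N} =
2^{−N}(M^{⊗N})^{⊗3}·P^{⊠N} and tensorRank is GL³- and scalar-invariant (TensorRankFacts /
OrbitClosure lemmas in tree). [difficulty: provable-now] [AlmanLi2026,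
ConnerGesmundoLandsbergVentura2022]
#9 CWPointFlat (support) — the CW point itself, R~(T_cw,2) = 3 in growth form — identical signature
to AsymptoticRankCW.BThesis (stmt-MatrixMultiplication-0588; shared by dedup, wanted by both
routes): the instance (0,1,1) of X_HES and the special case through which the assembly runs.
[difficulty: open-problem] [Blaser2013, CoppersmithWinograd1990, ConnerGesmundoLandsbergVentura2022,
AlmanLi2026]
#9 CWPointAssembly (support) — BThesis → MatrixMultiplication — identical signature to
AsymptoticRankCW.Assembly (stmt-MatrixMultiplication-0589; shared): provable now from the PROVED
fact CoppersmithWinograd1990_asymptoticRank_form_holds (q := 2, ρ := 3;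
CoppersmithWinograd1990Proofs.lean) via matrixMultiplication_of_cw_two and omega_ge_two
(Theorems/AsymptoticSpectrumOmegaGeTwo.lean). [difficulty: provable-now] [CoppersmithWinograd1990,
ConnerGesmundoLandsbergVentura2022, BurgisserClausenShokrollahi1997, Blaser2013]
#9 WeylSymmetry (support) — Weyl-group bookkeeping: for ω² + ω + 1 = 0, all (a,b,c) and all N,
R(u(a,b,c)^{⊠N}) is unchanged under C (a,b,c)↦(b,c,a) [translate y ↦ y−1, z ↦ z+1], S (a,c,b)
[transpose factors 2,3], D (a,ωb,ω²c) [characters diag(ω^{−x}), diag(ω^{y}) on factors 1,2], D′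
(a,ωb,ωc) [diag(1,ω,1) on all three factors] and the Fourier element F (a+b+c, a+ω²b+ωc, a+ωb+ω²c)
[DFT⊗DFT⊗DFT maps u(a,b,c) to 3·u(F(a,b,c)); all five verified exactly this session]; gives provers
a fundamental domain and transports every pointwise result along W-orbits (e.g. F(0,1,1) =
(2,−1,−1): cw₂ is conjugate to a nowhere-zero weighting, card item C3). [difficulty: provable-now]
[Vinberg1976, BremnerHuOeding2014, Nurmiev2000]
#9 LowerFrame (support) — lower frame making "= 3" meaningful: for (a,b,c) ≠ 0 and all N, 3^N ≤
R(u(a,b,c)^{⊠N}) (the three x-slices are nonzero with disjoint supports, so every flattening rank is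
3, and flattening rank is multiplicative under Kronecker powers and bounds tensorRank below:
FlatteningRank / CwPowerFlattening pattern in tree). [difficulty: provable-now]
[ConnerGesmundoLandsbergVentura2022, BurgisserClausenShokrollahi1997]
#9 MarginalsFlat (support) — flat marginals (rev-1 replacement of the rev-0 item QuantumFlat,
dropped together with the QuantumFunctionals import in the cone repair of 2026-08-15): for ALL
(a,b,c) ∈ ℂ³ the three reduced density matrices flatten_i(u)·flatten_i(u)ᴴ (i = 1,2,3) of u(a,b,c)
equal (|a|²+|b|²+|c|²)·I₃, stated over Mathlib matrices only (every slice of the support {x+y+z ≡ 0}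
is a permutation pattern carrying each weight a,b,c exactly once, and distinct slices have disjoint
supports; verified exactly). What it buys, derivable by a prover in a Theorems file (which may
import QuantumFunctionals freely — only the route file must not): every quantum functional
F^θ(u(a,b,c)) = 3 for θ in the simplex and (a,b,c) ≠ 0 (with the PROVED CVZ lemmas
quantumEntropy_le_logQuantumFunctional / logQuantumFunctional_le: the quantum entropy at g = 1
already equals the dimension bound log₂3), i.e. every catalogued spectral lower bound is blind on
the punctured plane (card free theorem (i)); and the SL₃³ moment map vanishes at u, so u is a
minimal vector with closed orbit (Kempf–Ness) — the plane is polystable, which is why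
UnstableTensorBarrier is silent here. [difficulty: provable-now] [ChristandlVranaZuiddam2023,
BremnerHuOeding2014, Nurmiev2000]
#9 UnitPoints (support) — the twelve unit points: u(a,b,c) has rank ≤ 3 at the 3 coordinate points
(a single X_i, a relabelled ⟨3⟩) and at the 9 points a³ = b³ = c³ (u(1,1,1) = [x+y+z ≡ 0] = ⅓Σ_χ
χ⊗χ⊗χ, and u(1,ωⁱ,ωʲ) is its image under the diagonal torus generated by D, D′ — verified for all
nine); these are the 12 double points of the mirror arrangement and, with 0, exhaust {R ≤ 3} ∩ 𝔠
(converse via I₉ and I₆³ : I₁₂, not filed). [difficulty: provable-now] [BremnerHuOeding2014,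
Nurmiev2000]

TWO-LAYER PLAN. Foreseen glued splits (none filed now): HessianPlaneFlat ⇐ GenericFlat (R~ ≤ 3 on a
Zariski-dense subset of 𝔠) → ClosureTransfer ((h :
CHNVZ sublevel-closedness, to be vendored as a named fact) → GenericFlat → HessianPlaneFlat);
HessianSquareBound ⇐ GenericSquare22 (one rank-22
Bini scheme over ℂ(a,b,c)[ε]) → SemicontinuitySpecialise → HessianSquareBound; UnitGap ⇐
HesseLineGap (b = c, smooth cubics: β₂ = 16) →
GenericKoszul16 (Koszul rank of u⊠u ≥ 16·k off a W-stable curve, by semicontinuity from the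
Levi-Civita point) → UnitGap, transported by
WeylSymmetry. A second assembly path through the Levi-Civita point (0,1,−1) (X_HES →
AsymptoticRankCW.BDet3AsymptoticRank → summit) waits for
the skew CW90 bound (ConnerGesmundoLandsbergVentura2022 Prop 2.2), not yet in Literature.

KILL CRITERIA. A certified dark point — a universal spectral point F and (a,b,c) with F(u(a,b,c)) >
3, or any proof of R~(u) > 3 at one plane point — refutes
HessianPlaneFlat: close `refuted:HessianPlaneFlat` if the point lies in the W-orbit of (0,1,1) or
(0,1,−1) (then AsymptoticRankCW dies too);
if it is a generic/mirror point only, pivot by restating the target to the W-orbits of the two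
summit points plus the mirror family c = 0
(CHNVZ §5). ω(ℂ) > 2 (routes BorderRankLowerBound, NilCoxeterShadow) closes everything.
PlaneUniformFour refuted = a dark point, same as above.
HessianSquareBound refuted (a Koszul/apolarity bound ≥ 23 at one point) kills only that crux and
CGLV Theorem* 2.13 — re-rank, keep the line;
UnitGap refuted (a rank-15 border scheme for some smooth Hesse cubic's square) is informative, not
fatal: it names a semisimple tensor more
unit-like than cw₂ at degree 2 and re-ranks the plane's minimum. BThesis proved elsewhere moots the
Assembly (summit closed), not the cruxes.

NOT DECOMPOSED YET. The laser-method assembly is not re-derived (PROVED fact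
CoppersmithWinograd1990_asymptoticRank_form_holds). Not filed at open: the equivalence
X_HES ⇔ ARC(3,3,3) (needs CHNVZ closedness as a Literature fact — cite item requested — and density
of G·𝔠 via the Jacobian of
SL₃³ × 𝔠 → ℂ²⁷ plus Chevalley constructibility); the converse of UnitPoints ({R ≤ 3} ∩ 𝔠 = the 12
points, needs Strassen's degree-9 invariant
and a degree-6 invariant in Lean); Q~ ≡ 3 on the plane (known on the tight sublocus by Strassen1991,
open-looking at non-tight generic points —
deliberately NOT claimed); the Levi-Civita glue (skew CW90 bound); cubes (bR(u^{⊠3}) as a function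
on 𝔠, 27×27×27 — only after
HessianSquareBound lands); any W-equivariant Alman–Li speed-up FUNCTION (their Prop 4.3 degeneration
⟨3⟩ ⊕ ⟨1,2,1⟩ ⊵ T is already uniform in T;
making the Strassen-calculus bound depend on (I₆ : I₉ : I₁₂) is layer-2 work under
PlaneUniformFour).

CHEAPEST FALSIFIER. For the cruxes: Koszul-flattening ranks (p = 1…4) of u(a,b,c)⊠u(a,b,c) ∈
ℂ⁹⊗ℂ⁹⊗ℂ⁹ at ONE random rational point (exact linear algebra on
matrices of size ≤ 9·C(8,4)): a certified lower bound ≥ 23 kills HessianSquareBound together with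
CGLV Theorem* 2.13; the same ranks along the
Hesse line (a,b,b) tell whether UnitGap's open window is really {15,16}. For the target there is no
cheap kill: arXiv:2601.21553 (support
functionals = quantum functionals) and MarginalsFlat (flat marginals ⇒ every quantum functional
equals 3 off the origin) mean every catalogued spectral point equals 3 on the plane; the cheapest
meaningful attack is
a refuter's search for a non-quantum monotone at a generic plane point (2 parameters, all marginal
data flat). Run this session: exact checks
that u(0,1,1) = cw₂′, u(0,1,−1) = the BDet3 Levi-Civita tensor (Lean, by decide), the five Weyl
generators, the nine torus identities behind
UnitPoints and T_cw,2 = ½(M⊗M⊗M)·cw₂′ (exact arithmetic) — all passed; the card's claim (iv) (unit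
locus = 3 character points) FAILED and is
corrected to 12 points, and its "tight" claim fails generically (CGLVW Thm 1.9).

NUMBERS. Border rank on 𝔠: 3 at the 12 unit points; 4 exactly on the 9 lines a³=b³, b³=c³, c³=a³
({I₉ = 0}, BremnerHuOeding2014 §4 and Table: I₉ = 0 iff
bR ≤ 4; Strassen's equation); 5 elsewhere (generic, ConnerGesmundoLandsbergVentura2022 §2.4).
Squares: 9 at units; 16 at the cw₂-orbit
(ConnerHuangLandsberg2020 Thm 1.1; CGLV Thm 1.2: 15 ≤ · ≤ 16); 17 at the Levi-Civita orbit (square ≅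
det₃: CGLV Thm 2.7 ≤ 17, ConnerHarperLandsberg2019
= 17); ≤ 22 numerically for all (CGLV Thm* 2.13); CGLV Prop 6.2: T_t11μ (bR 4) square ∈ [15,16],
T_t11(−1) (bR 5) square ∈ [16,19], several bR-4
tight tensors with squares ≤ 14 numerically (semisimplicity unchecked). Asymptotic rank: 3 ≤ R~(cw₂)
= R~(cw₂′) < 3.931 (AlmanLi2026 Thm 1.3, Cor 7.2);
every 3×3×3 tensor: R~ ≤ 3 + 2^{ω/3} < 4.7297 (AlmanLi2026 Cor 4.1, via Prop 4.3: T ⊴ ⟨3⟩ ⊕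
⟨1,2,1⟩), ≤ 3^{2ω/3} (Strassen, CGLV Rem 1.3);
Kaski–Michałek census: no improvement below 5 at format (3,3,3) (arXiv:2601.08119 §4.1, σ₄ is a
degree-9 hypersurface). Symmetry: W ≅ G₂₅ of
order 648 = 6·9·12, PW = Hessian group of order 216; Δ₃₃₃|𝔠 = −4a³b³c³·Π_{i,j}(a+ωⁱb+ωʲc)³ (12
mirrors, BremnerHuOeding2014 eq. (array)), 12 double
points = units, 9 quadruple points = Levi-Civita orbit. Items at open: 12 (1 target, 3 cruxes, 7
support, 1 assembly). Rev 1 (cone + glue repair, 2026-08-15): QuantumFlat dropped for MarginalsFlat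
— again 12 items (1 target, 3 cruxes, 7 support, 1 assembly); route-file imports =
AsymptoticSpectrum only (its three named facts gaugePoint_isUniversalSpectralPoint,
strassen_duality_asymptoticRank, strassen_duality_asymptoticSubrank are all PROVED in tree; the
unproved XL fact Strassen1991_upperSupportFunctional rode in on QuantumFunctionals and was needed by
no item); deciding theorem `closes : HessianPlaneFlat → HesseToCW → CWPointAssembly →
MatrixMultiplication` (composition).

DEFINITION REQUESTS. None: u(a,b,c) and its Kronecker powers are inlined over
`kroneckerPow`/`tensorRank` and Mathlib matrices (all in tree; every constant
`lean search`-ed; Sketch.lean rc 0). Cite fact wanted (filed after open as a cite item): CHNVZ =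
arXiv:2411.15789 Thm 1.2 (sublevel sets
{T : R~(T) ≤ r} are Zariski closed, hence Euclidean closed) for format (3,3,3), as `(h : …)` for the
layer-2 ClosureTransfer glue.

Novelty: Searches (2026-08-15): `lit search --hybrid "asymptotic rank generic 3x3x3 tensor Cartan subspace
semisimple normal form Weyl group invariants
Kronecker square border rank"` (12 rows: Landsberg2017, BCS and Lie-theory textbooks only); `lit
search --source zbmath` ×3 ("Kronecker square
border rank generic tensor symbolic proof asymptotic rank conjecture small format": 0; "tensor
asymptotic rank semisimple orbits SL3 x SL3 x SL3
Nurmiev": 0; "border rank Kronecker square plane cubic": 1 irrelevant); OpenAlex / arXiv API: HTTP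
429 all session (recorded); `lit galaxy search
"asymptotic rank conjecture" --star all` (2: LandsbergMichalek haystack, CGLVW); `lit frontier
MatrixMultiplication --since 2023` (30 rows; read:
arXiv:2601.08119 census §4–5, arXiv:2605.21738); full-text greps of arXiv:1909.04785 (Thm* 2.13,
Problem 2.14, Rem 1.3, Prop 6.1/6.2),
arXiv:1811.05511 (§1, Thm 1.9), arXiv:2411.15789 (§5), arXiv:1310.3257 (§4: normal form, I₆, I₉,
I₁₂, Δ on 𝔠, five families), arXiv:2605.21738
(Prop 4.3, Cor 4.1, §7.1 cw₂′); the 12 existing routes and the two sibling cards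
(hesse-pencil-hamming-shells, hesse-pencil-j-line-semicontinuity).
Nearest prior art found: ConnerGesmundoLandsbergVenturaWang2020 §1 + Thm 1.9 ("ω = 2 would follow
from the m = 3 case of any ARC generalisation";
numerical 22 as evidence) and arXiv:2411.15789 §5 (cw₂ ≤ generic R~ of the hyperdeterminant-0 family
= the mirror family of 𝔠) for the thesis;
BremnerHuOeding2014 / Nurmiev2000 / Vinberg1976 for the plane;  [refs: 2601.08119, 2605.21738, 1909.04785, 1811.05511, 2411.15789, 1310.3257, Landsberg2017, ConnerGesmundoLandsbergVenturaWang2020, BremnerHuOeding2014, Nurmiev2000, Vinberg1976, ConnerGesmundoLandsbergVentura2022]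

Barriers (technique_class: theta-group-symmetry, small-format-arc, kronecker-powers): - technique_class: theta-group-symmetry, small-format-arc, kronecker-powers
- Literature.Barriers.MatrixMultiplication.IrreversibilityBarrier: applies only to the Assembly's
fixed intermediate tensor cw₂ (CW90 easy construction) and is numerically void at q = 2
(evasions_known (ii), CVZ Rem. 20: bound = 2); it bites iff R~(cw₂) > 3, i.e. iff the target is
false at (0,1,1) — barrier and kill criterion coincide; no plane point is ever used as an
intermediate tensor except cw₂.
- Literature.Barriers.MatrixMultiplication.UniversalMethodBarrier: same verdict (evasions_known (i):
tensors with S~ = R~ unobstructed, ω_u bound = 2 at cw₂); the cruxes are statements about ranks of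
Kronecker powers, not a universal-method analysis.
- Literature.Barriers.MatrixMultiplication.UnstableTensorBarrier: does not apply by theorem — every
plane point has a closed SL₃³-orbit (semisimple, BremnerHuOeding2014 Def 4.1 / Nurmiev2000), so is
not in the null cone, and off the 12 unit points is not of minimal border rank; evasions_known (ii)
names cw₂ explicitly. The plane is precisely the slice where BL2020 is silent.
- Literature.Barriers.MatrixMultiplication.RectangularBarrier: no T-method, no rectangular shapes,
square ω only — not in class.
- Literature.Barriers.MatrixMultiplication.InfimumNotMinimumBarrier: respected — every statement is
a rate over N or a closure (border) statement; no single finite algorithm is asserted to give ω = 2.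
- Literature.Barriers.MatrixMultiplication.LinearRankMethodBa

Novelty grade: new-combination — ROUTE REVIEW (refuter 2026-08-15). ELAB: all 12 decls rc0; kroneckerPow ≡ inline ∏-form of 0588. SUPPORTS verified TRUE on paper: WeylSymmetry (C=relabel y↦y+1,z↦z−1; S=factor swap; D,D′ diagonal; F: DFT⊗3·u(w)=3u(F(w)) computed), LowerFrame (x-slices disjoint supports each carrying a,b,c ⇒ flatteni (refuter refuter-rreview-route-CriticalPhenomena--64a1fcbe-0, 2026-08-15T13:36:13Z; prior: route AsymptoticRankCW (BThesis stmt-0588 / Assembly stmt-0589 shared verbatim) + CoppersmithWinograd1990_asymptoticRank_form_holds (proved), ConnerGesmundoLandsbergVentura2022 arXiv:1909.04785 Thm* 2.13 / Problem 2.14, Prop 6.1-6.2 (read pp.6,18-19), ConnerGesmundoLandsbergVenturaWang2020 arXiv:1811.05511 §1, Thm 1.9 (m=3 ARC ⇒ ω=2), BremnerHuOeding2014 arXiv:1310.3257 §4 / Nurmiev2000 / Vinberg1)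

History (route lifecycle, newest last):
- 2026-08-15T16:16:40Z · rev 1: dropped QuantumFlat — route-repair (rbadge g2): deciding theorem closes : HessianPlaneFlat → HesseToCW → CWPointAssembly → MatrixMultiplication (composition; native preview h21_check (planner-rbadge-MatrixMultiplication-HessianPla-f392c9b7-g2-0)
- 2026-08-16T04:10:51Z · AUTO-CRUX (backfill): HessianPlaneFlat — hypotheses of the deciding theorem that nothing in the route derives are cruxes (operator:999:1085951)
- 2026-08-25T03:31:25Z · DORMANT — reconciler: no traction for 7.3 d (last activity item-evidence-added at 2026-08-17T18:57:05Z); parked, not closed — `ledger route dormant route-MatrixMultiplica (operator:999:2769503)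

sub-problem: MatrixMultiplication · status: dormant · opened planner-plancard-MatrixMultiplication-MatrixM-fc9eba19-0 2026-08-15T11:35:32Z · rev 2 · ledger route-MatrixMultiplication-HessianPlane
GENERATED by the gate from the ledger (D-0016/17). Provers cite these decls: `theorem foo : Summit.MatrixMultiplication.MatrixMultiplication.Theses.HessianPlane.<Decl> := …` in Summits/MatrixMultiplication/MatrixMultiplication/Theorems/<Name>.lean.
-/

namespace Summit.MatrixMultiplication.MatrixMultiplication.Theses.HessianPlane

open scoped BigOperators Topology Manifold Classical MeasureTheory ProbabilityTheory Matrix InnerProductSpace ComplexConjugate ContinuousMap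
open Filter Set Function TopologicalSpace MeasureTheory

attribute [summit_statement] _root_.MatrixMultiplication

/-- item stmt-MatrixMultiplication-4891 · crux (kind.auto-crux: conjecture-grade) · rank 0 · open · by planner
why it might fail: Equivalent to ARC for ALL 3×3×3 tensors (closedness + semisimple density); generic points are free but not tight, bR 5, and nothing below 4.69 is known off the 12 unit points; one dark spectral point anywhere on the plane refutes it.
sources: BurgisserClausenShokrollahi1997, ConnerGesmundoLandsbergVenturaWang2020, arXiv:2411.15789, Nurmiev2000, Vinberg1976, BremnerHuOeding2014
[target] for all (a,b,c) ∈ ℂ³ and ε > 0, R(u(a,b,c)^{⊠N}) = O(3^{(1+ε)N}): asymptotic rank is ≤ 3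
(hence = 3 off the origin) on the whole Hessian plane; card item C1. -/
@[route_item "route-MatrixMultiplication-HessianPlane", crux]
def HessianPlaneFlat : Prop :=
  ∀ a b c : ℂ, ∀ ε : ℝ, 0 < ε → (fun N : ℕ => (Literature.Computability.AlgebraicComplexity.tensorRank (Literature.Computability.AlgebraicComplexity.kroneckerPow (fun x y z : Fin 3 => if x + y + z = 0 then ![a, b, c] (y - x) else (0 : ℂ)) N) : ℝ)) =O[Filter.atTop] fun N : ℕ => (3 : ℝ) ^ ((1 + ε) * N)

/-- item stmt-MatrixMultiplication-18179 · crux · rank 2 · open · by planner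
why it might fail: R̃ may drop on a W-invariant curve inside U that border rank and Δ do not see (e.g. where the Kronecker square's border rank drops below its generic value 22, or on I₆ = 0 / I₁₂ = 0); one universal spectral point non-constant on U refutes it.
sources: arXiv:2411.15789, BremnerHuOeding2014, ConnerGesmundoLandsbergVentura2022, ChristandlVranaZuiddam2023, Vinberg1976, Nurmiev2000
[crux] REGULAR CONSTANCY — piece 1 of the BC2-redirect split HessianPlaneFlat ⇐ RegularConstancy ∧
RegularFlatPoint (crux-strategist 2026-08-17; assembly hessianPlaneFlat_of_subs PROVED, evidence on
stmt-4891 / Cruxes/HessianPlaneFlat/Lines/regular_split.lean). Let P(a,b,c) =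
abc·(a³−b³)(b³−c³)(c³−a³)·((a³+b³+c³)³−27a³b³c³), the defining polynomial of the 21 lines of the
reflection arrangement of G₂₆ ⊃ W = G₂₅ on the Hessian plane: the 12 mirrors abc·∏_{i,j}(a+ωⁱb+ωʲc)
= 0 of G₂₅ (hyperdeterminant Δ = 0; they carry the Coppersmith–Winograd orbit W·(0,1,1) and the
Levi-Civita orbit W·(0,1,−1)) and the 9 lines a³=b³, b³=c³, c³=a³ ({I₉ = 0} = border rank ≤ 4,
containing the 12 unit points). The regular set U = {P ≠ 0} has border rank 5, Δ ≠ 0, no summit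
point, no unit point. Claim: the asymptotic rank R̃(u(a,b,c)) (tree asymptoticRank = inf_N
R(u^{⊠N})^{1/N}) takes ONE value on U — 'asymptotic rank drops only where border rank or the
hyperdeterminant drops'. It fixes no value (implies neither HessianPlaneFlat nor ω = 2; cheap probes
fail) and is implied by HessianPlaneFlat. Free partial results: constancy on points with
algebraically independent coordinates (Aut(ℂ)-invariance of tenso -/
@[route_item "route-MatrixMultiplication-HessianPlane"]
def RegularConstancy : Prop :=
  ∀ a b c a' b' c' : ℂ, a * b * c * (a ^ 3 - b ^ 3) * (b ^ 3 - c ^ 3) * (c ^ 3 - a ^ 3) * ((a ^ 3 + b ^ 3 + c ^ 3) ^ 3 - 27 * a ^ 3 * b ^ 3 * c ^ 3) ≠ 0 → a' * b' * c' * (a' ^ 3 - b' ^ 3) * (b' ^ 3 - c' ^ 3) * (c' ^ 3 - a' ^ 3) * ((a' ^ 3 + b' ^ 3 + c' ^ 3) ^ 3 - 27 * a' ^ 3 * b' ^ 3 * c' ^ 3) ≠ 0 → Literature.Computability.AlgebraicComplexity.asymptoticRank (fun x y z : Fin 3 => if x + y + z = 0 then ![a, b, c] (y - x) else (0 : ℂ))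 = Literature.Computability.AlgebraicComplexity.asymptoticRank (fun x y z : Fin 3 => if x + y + z = 0 then ![a', b', c'] (y - x) else (0 : ℂ))

/-- item stmt-MatrixMultiplication-4892 · crux · rank 2 · open · by planner
why it might fail: CGLV's 22 is floating-point ALS at random points (Thm* 2.13, ℓ₂-evidence only); the exact generic value may be 23–25, and a rank-22 scheme over ℂ(a,b,c)[ε] may need a finite extension (monodromy of W) or not exist even if pointwise limits do.
sources: ConnerGesmundoLandsbergVentura2022, ConnerGesmundoLandsbergVenturaWang2020, ConnerHuangLandsberg2020, BremnerHuOeding2014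
[crux] uniformly on the plane, the Kronecker square drops: bR(u(a,b,c)⊠u(a,b,c)) ≤ 22 < 25 for ALL
(a,b,c) — CGLV Theorem* 2.13 (numerical) made symbolic on 𝔠, i.e. their Problem 2.14; by density of
semisimple orbits and closedness of σ₂₂ this is the statement for every 3×3×3 tensor. The plane
makes a uniform proof conceivable: ONE border decomposition of rank 22 over ℂ(a,b,c)[ε]
(W-equivariance and the (ℤ/3)²-translation symmetry of u⊠u cut the search), specialising to 16 at
the cw₂-orbit and 17 at the Levi-Civita orbit. Card item C2 (degree-2 border-rank map β₂).
[difficulty: L] -/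
@[route_item "route-MatrixMultiplication-HessianPlane"]
def HessianSquareBound : Prop :=
  ∀ a b c : ℂ, Literature.Computability.AlgebraicComplexity.kroneckerPow (fun x y z : Fin 3 => if x + y + z = 0 then ![a, b, c] (y - x) else (0 : ℂ)) 2 ∈ closure {s : (Fin 2 → Fin 3) → (Fin 2 → Fin 3) → (Fin 2 → Fin 3) → ℂ | Literature.Computability.AlgebraicComplexity.tensorRank s ≤ 22}

/-- item stmt-MatrixMultiplication-18180 · crux · rank 3 · open · by planner
why it might fail: It is ARC at a border-rank-5 point of format (3,3,3): nothing below 3 + 2^{ω/3} < 4.7297 (AlmanLi2026 Cor 4.1) is proved there and the Kronecker square has border rank ≈ 22 > 9 numerically (CGLV Thm* 2.13); false as soon as the generic 3×3×3 asymptotic rank exceeds 3.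
sources: BurgisserClausenShokrollahi1997, ConnerGesmundoLandsbergVenturaWang2020, ConnerGesmundoLandsbergVentura2022, AlmanLi2026, arXiv:2411.15789, ChristandlVranaZuiddam2023
[crux] ONE FLAT REGULAR POINT — piece 2 of the BC2-redirect split HessianPlaneFlat ⇐
RegularConstancy ∧ RegularFlatPoint (crux-strategist 2026-08-17; assembly PROVED). There is (a,b,c)
off the 21-line G₂₆ arrangement (P(a,b,c) = abc·(a³−b³)(b³−c³)(c³−a³)·((a³+b³+c³)³−27a³b³c³) ≠ 0:
border rank 5, Δ ≠ 0, not a summit point, not a unit point) with R̃(u(a,b,c)) ≤ 3 (tree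
asymptoticRank; = 3 by the flattening bound LowerFrame; equivalent to the route's growth form
R(u^{⊠N}) = O(3^{(1+ε)N}) by Fekete, AsymptoticRankLimit.lean /
exists_const_tensorRank_kroneckerPow_le). This is the concise asymptotic-rank conjecture (BCS
Problem 15.5; CGLVW2020 §1: 'ω = 2 would follow from the m = 3 case') for ONE bR-generic semisimple
3×3×3 tensor of the prover's choosing (e.g. a regular point with extra stabiliser in G₂₆). It
contains no summit point: the CW orbit W·(0,1,1) and the Levi-Civita orbit W·(0,1,−1) lie ON the
arrangement, distinct plane points have distinct closed SL₃³-orbits (no degeneration between them),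
and no asymptotic comparison from a regular point to cw₂ is known — so it implies ω = 2 by nothing
in tree or in print (cheap probes fail), while with RegularConstancy and CHNVZ closedne -/
@[route_item "route-MatrixMultiplication-HessianPlane"]
def RegularFlatPoint : Prop :=
  ∃ a b c : ℂ, a * b * c * (a ^ 3 - b ^ 3) * (b ^ 3 - c ^ 3) * (c ^ 3 - a ^ 3) * ((a ^ 3 + b ^ 3 + c ^ 3) ^ 3 - 27 * a ^ 3 * b ^ 3 * c ^ 3) ≠ 0 ∧ Literature.Computability.AlgebraicComplexity.asymptoticRank (fun x y z : Fin 3 => if x + y + z = 0 then ![a, b, c] (y - x) else (0 : ℂ)) ≤ 3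

/-- item stmt-MatrixMultiplication-4893 · crux · rank 3 · open · by planner
why it might fail: A smooth Hesse cubic has bR 4, Koszul bound 15 and no degeneration to cw₂ forcing 16; CGLV Prop 6.2 lists bR-4 tight 3×3×3 tensors with squares numerically ≤ 14 — if one of them, or one smooth cubic, is a plane point with square ≤ 15, false.
sources: ConnerHuangLandsberg2020, ConnerGesmundoLandsbergVentura2022, ConnerHarperLandsberg2019, BremnerHuOeding2014, Nurmiev2000
[crux] the degree-2 map detects units with a gap: if bR(u(a,b,c)⊠u(a,b,c)) ≤ 15 then bR(u(a,b,c)) ≤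
3 (u is one of the 12 unit points or 0). Equivalently β₂ ≥ 16 = β₂(cw₂) (ConnerHuangLandsberg2020)
at every non-unit point, so the CW orbit MINIMISES the square's border rank among non-units (card
check (β): "the summit points are the most unit-like semisimple tensors"). Forced at generic points
of bR 5 by semicontinuity of Koszul ranks from the Levi-Civita point (square = det₃, Koszul 16, bR
17); the content is the 9 lines of border rank 4 = W·(Hesse pencil of plane cubics aX₁+b(X₂+X₃)),
where only 15 ≤ β₂ ≤ 16 is known for smooth members. [difficulty: L] -/
@[route_item "route-MatrixMultiplication-HessianPlane"]
def UnitGap : Prop :=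
  ∀ a b c : ℂ, Literature.Computability.AlgebraicComplexity.kroneckerPow (fun x y z : Fin 3 => if x + y + z = 0 then ![a, b, c] (y - x) else (0 : ℂ)) 2 ∈ closure {s : (Fin 2 → Fin 3) → (Fin 2 → Fin 3) → (Fin 2 → Fin 3) → ℂ | Literature.Computability.AlgebraicComplexity.tensorRank s ≤ 15} → (fun x y z : Fin 3 => if x + y + z = 0 then ![a, b, c] (y - x) else (0 : ℂ)) ∈ closure {s : Fin 3 → Fin 3 → Fin 3 → ℂ | Literature.Computability.AlgebraicComplexity.tensorRank s ≤ 3}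

/-- item stmt-MatrixMultiplication-4894 · crux · rank 4 · open · by planner
why it might fail: Nothing below 3+2^{ω/3} < 4.7297 (AlmanLi2026 Cor 4.1) is proved at a generic point (bR 5; 22 only numerically; the Kaski–Michałek census gets no improvement at format (3,3,3)); ρ_gen may exceed 4, which would separate cw₂ from the generic tensor instead.
sources: AlmanLi2026, ConnerGesmundoLandsbergVentura2022, arXiv:2601.08119, arXiv:2411.15789
[crux] every point of the plane — hence every semisimple, hence (closedness) every 3×3×3 tensor —
has asymptotic rank ≤ 4 = bR(cw₂): for all (a,b,c), ε > 0, R(u(a,b,c)^{⊠N}) = O(4^{(1+ε)N}). The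
first uniform threshold below the generic border rank 5 beyond the numerical √22 ≈ 4.690 and
Alman–Li's rigorous 3 + 2^{ω/3} < 4.7297 (Cor 4.1); by W-invariance and closedness equivalent to ρ ≤
4 at one generic point. A way-point to X_HES that already says "no 3×3×3 tensor is asymptotically
more expensive than cw₂ is naively" (card: ρ-upper-bound function from W-equivariant speed-ups).
[deps: HessianSquareBound] [difficulty: open-problem] -/
@[route_item "route-MatrixMultiplication-HessianPlane"]
def PlaneUniformFour : Prop :=
  ∀ a b c : ℂ, ∀ ε : ℝ, 0 < ε → (fun N : ℕ => (Literature.Computability.AlgebraicComplexity.tensorRank (Literature.Computability.AlgebraicComplexity.kroneckerPow (fun x y z : Fin 3 => if x + y + z = 0 then ![a, b, c] (y - x) else (0 : ℂ)) N) : ℝ)) =O[Filter.atTop] fun N : ℕ => (4 : ℝ) ^ ((1 + ε) * N)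

/-- item stmt-MatrixMultiplication-0588 · support · rank 9 · open · by planner
sources: Blaser2013, CoppersmithWinograd1990, ConnerGesmundoLandsbergVentura2022, AlmanLi2026
X_B: asymptotic rank of the small Coppersmith–Winograd tensor T_cw,2 (on Fin 3, e_0 distinguished)
is 3: for every ε>0, R(T_cw,2^{⊗N}) = O(3^{(1+ε)N}); Kronecker power written inline over Fin N → Fin
3 (Blaser2013 §9.2 Problem 9.8; arXiv:1909.04785 §1.2). -/
@[route_item "route-MatrixMultiplication-HessianPlane"]
def CWPointFlat : Prop :=
  ∀ ε : ℝ, 0 < ε → (fun N : ℕ => (Literature.Computability.AlgebraicComplexity.tensorRank (K := ℂ) (fun a b c : Fin N → Fin 3 => ∏ i, (if (a i = 0 ∧ b i = c i ∧ b i ≠ 0) ∨ (b i = 0 ∧ a i = c i ∧ a i ≠ 0) ∨ (c i = 0 ∧ a i = b i ∧ a i ≠ 0) then (1 : ℂ) else 0)) : ℝ)) =O[Filter.atTop] fun N : ℕ => (3 : ℝ) ^ ((1 + ε) * N)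

/-- item stmt-MatrixMultiplication-0589 · support · rank 9 · closed · proved by Summit.MatrixMultiplication.MatrixMultiplication.Theorems.cwPointAssembly_proof @ 373a1da5ead4 (prover) · by planner
sources: CoppersmithWinograd1990, ConnerGesmundoLandsbergVentura2022, BurgisserClausenShokrollahi1997, Blaser2013
X_B → ω(ℂ) = 2: Coppersmith–Winograd 1990 easy construction via the laser method with asymptotic
rank in place of border rank: ω ≤ log_q(4·R~(T_cw,q)^3/27), q = 2 (Blaser2013 §9.2 p46–47;
ConnerGesmundoLandsbergVentura2022 = arXiv:1909.04785 Thm 1.1 + BCS Ex. 15.24). Substantial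
Literature theorem (τ-theorem Blaser2013 Thm 7.5, Thm 9.6); expect re-filing as (h : Fact) → …. -/
@[route_item "route-MatrixMultiplication-HessianPlane", crux]
def CWPointAssembly : Prop :=
  (∀ ε : ℝ, 0 < ε → (fun N : ℕ => (Literature.Computability.AlgebraicComplexity.tensorRank (K := ℂ) (fun a b c : Fin N → Fin 3 => ∏ i, (if (a i = 0 ∧ b i = c i ∧ b i ≠ 0) ∨ (b i = 0 ∧ a i = c i ∧ a i ≠ 0) ∨ (c i = 0 ∧ a i = b i ∧ a i ≠ 0) then (1 : ℂ) else 0)) : ℝ)) =O[Filter.atTop] fun N : ℕ => (3 : ℝ) ^ ((1 + ε) * N)) → MatrixMultiplication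

/-- item stmt-MatrixMultiplication-18186 · support · rank 9 · open · by planner
[support] SPLIT GLUE (BC2 redirect, crux-strategist 2026-08-17): RegularConstancy → RegularFlatPoint
→ HessianPlaneFlat — makes the deciding crux HessianPlaneFlat the DERIVED node of the two
regular-set pieces. PROVED sorry-free already: theorem hessianPlaneFlat_of_subs in
Cruxes/HessianPlaneFlat/Lines/regular_split.lean (commit 0d2c5519f57a; also attached as evidence
HessianPlaneHessianPlaneFlatSplit.lean on stmt-4891; lean check rc0, 0 warnings, axioms
propext/Classical.choice/Quot.sound, ~300 lines) — a prover lands that file verbatim as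
Theorems/HessianPlaneHessianPlaneFlatSplit.lean and closes this item by `theorem … :
HessianPlane.HessianPlaneFlatOfRegular := fun h₁ h₂ => hessianPlaneFlat_of_subs h₁ h₂` (the pieces
unfold to the inlined hypotheses verbatim). Proof content: (1) the pieces give R̃(u) ≤ 3 on the
regular set U = {P ≠ 0}; (2) U is dense: with ω² + ω + 1 = 0, P =
abc·∏_k(a−ωᵏb)(b−ωᵏc)(c−ωᵏa)·∏_{i,j}(a+ωⁱb+ωʲc) is a product of 21 linear forms, none vanishing at
(1,2,4), so (a,b,c) + (1,2,4)/(n+1) is regular for all large n; (3) {t : R̃(t) ≤ 3} is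
Euclidean-closed (CHNVZ 2025 Thm 1.2 = chnvz_zariskiClosed_asymptoticRank_le_holds.isClosed_complex,
proved in tree) and -/
@[route_item "route-MatrixMultiplication-HessianPlane"]
def HessianPlaneFlatOfRegular : Prop :=
  RegularConstancy → RegularFlatPoint → HessianPlaneFlat

/-- item stmt-MatrixMultiplication-4895 · support · rank 9 · closed · proved by Summit.MatrixMultiplication.MatrixMultiplication.Theorems.hesseToCW_proof @ 48f838a59a5b (prover) · by planner
sources: AlmanLi2026, ConnerGesmundoLandsbergVentura2022
[support] the CW point: X_HES → BThesis of route AsymptoticRankCW (stmt-MatrixMultiplication-0588,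
body inlined). Proof: instance (a,b,c) = (0,1,1); u(0,1,1) = P := [x,y,z pairwise distinct]
(Sketch.lean example, by decide), and T_cw,2 = ½·(M⊗M⊗M)·P with M = [[1,0,0],[0,1,1],[0,i,−i]]
(cubic forms 6x₀x₁x₂ ↦ 6x₀(x₁²+x₂²); verified exactly), so T_cw,2^{⊠N} = 2^{−N}(M^{⊗N})^{⊗3}·P^{⊠N}
and tensorRank is GL³- and scalar-invariant (TensorRankFacts / OrbitClosure lemmas in tree).
[difficulty: provable-now] -/
@[route_item "route-MatrixMultiplication-HessianPlane", crux]
def HesseToCW : Prop :=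
  HessianPlaneFlat → ∀ ε : ℝ, 0 < ε → (fun N : ℕ => (Literature.Computability.AlgebraicComplexity.tensorRank (K := ℂ) (fun a b c : Fin N → Fin 3 => ∏ i, (if (a i = 0 ∧ b i = c i ∧ b i ≠ 0) ∨ (b i = 0 ∧ a i = c i ∧ a i ≠ 0) ∨ (c i = 0 ∧ a i = b i ∧ a i ≠ 0) then (1 : ℂ) else 0)) : ℝ)) =O[Filter.atTop] fun N : ℕ => (3 : ℝ) ^ ((1 + ε) * N)

/-- item stmt-MatrixMultiplication-4896 · support · rank 9 · closed · proved by Summit.MatrixMultiplication.MatrixMultiplication.Theorems.weylSymmetry_proof @ c14a8a3a9642 (prover) · by planner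
sources: Vinberg1976, BremnerHuOeding2014, Nurmiev2000
[support] Weyl-group bookkeeping: for ω² + ω + 1 = 0, all (a,b,c) and all N, R(u(a,b,c)^{⊠N}) is
unchanged under C (a,b,c)↦(b,c,a) [translate y ↦ y−1, z ↦ z+1], S (a,c,b) [transpose factors 2,3], D
(a,ωb,ω²c) [characters diag(ω^{−x}), diag(ω^{y}) on factors 1,2], D′ (a,ωb,ωc) [diag(1,ω,1) on all
three factors] and the Fourier element F (a+b+c, a+ω²b+ωc, a+ωb+ω²c) [DFT⊗DFT⊗DFT maps u(a,b,c) to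
3·u(F(a,b,c)); all five verified exactly this session]; gives provers a fundamental domain and
transports every pointwise result along W-orbits (e.g. F(0,1,1) = (2,−1,−1): cw₂ is conjugate to a
nowhere-zero weighting, card item C3). [difficulty: provable-now] -/
@[route_item "route-MatrixMultiplication-HessianPlane"]
def WeylSymmetry : Prop :=
  ∀ ω : ℂ, ω ^ 2 + ω + 1 = 0 → ∀ a b c : ℂ, ∀ N : ℕ, Literature.Computability.AlgebraicComplexity.tensorRank (Literature.Computability.AlgebraicComplexity.kroneckerPow (fun x y z : Fin 3 => if x + y + z = 0 then ![a, b, c] (y - x) else (0 : ℂ)) N) = Literature.Computability.AlgebraicComplexity.tensorRank (Literature.Computability.AlgebraicComplexity.kroneckerPow (fun x y z : Fin 3 => if x + y + z = 0 then ![b, c, a] (y - x) else (0 : ℂ)) N) ∧ Literature.Computability.AlgebraicComplexity.tensorRank (Literature.Computability.AlgebraicComplexity.kroneckerPow (fun x y z : Fin 3 => if x + y + z = 0 then ![a, b, c] (y - x) else (0 : ℂ)) N) = Literature.Computability.AlgebraicComplexity.tensorRank (Literature.Computability.AlgebraicComplexity.kroneckerPow (fun x y z : Fin 3 => if x + y +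 z = 0 then ![a, c, b] (y - x) else (0 : ℂ)) N) ∧ Literature.Computability.AlgebraicComplexity.tensorRank (Literature.Computability.AlgebraicComplexity.kroneckerPow (fun x y z : Fin 3 => if x + y + z = 0 then ![a, b, c] (y - x) else (0 : ℂ)) N) = Literature.Computability.AlgebraicComplexity.tensorRank (Literature.Computability.AlgebraicComplexity.kroneckerPow (fun x y z : Fin 3 => if x + y + z = 0 then ![a, ω * b, ω ^ 2 * c] (y - x) else (0 : ℂ)) N) ∧ Literature.Computability.AlgebraicComplexity.tensorRank (Literature.Computability.AlgebraicComplexity.kroneckerPow (fun x y z : Fin 3 => if x + y + z = 0 then ![a, b, c] (y - x) else (0 : ℂ)) N) = Literature.Computability.AlgebraicComplexity.tensorRank (Literature.Computability.AlgebraicComplexity.kroneckerPow (fun x y z : Fin 3 => if x + y + z = 0 then ![a, ω * b, ω * c] (y - x) else (0 : ℂ)) N) ∧ Literature.Computability.AlgebraicComplexity.tensorRank (Literature.Computability.AlgebraicComplexity.kroneckerPow (fun x y z : Fin 3 => if x + y + z = 0 then ![a, b, c] (y - x) else (0 : ℂ)) N) = Literature.Computability.AlgebraicComplexity.tensorRank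 (Literature.Computability.AlgebraicComplexity.kroneckerPow (fun x y z : Fin 3 => if x + y + z = 0 then ![a + b + c, a + ω ^ 2 * b + ω * c, a + ω * b + ω ^ 2 * c] (y - x) else (0 : ℂ)) N)

/-- item stmt-MatrixMultiplication-4897 · support · rank 9 · closed · proved by Summit.MatrixMultiplication.MatrixMultiplication.Theorems.lowerFrame_proof (prover) · by planner
sources: ConnerGesmundoLandsbergVentura2022, BurgisserClausenShokrollahi1997
[support] lower frame making "= 3" meaningful: for (a,b,c) ≠ 0 and all N, 3^N ≤ R(u(a,b,c)^{⊠N})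
(the three x-slices are nonzero with disjoint supports, so every flattening rank is 3, and
flattening rank is multiplicative under Kronecker powers and bounds tensorRank below: FlatteningRank
/ CwPowerFlattening pattern in tree). [difficulty: provable-now] -/
@[route_item "route-MatrixMultiplication-HessianPlane"]
def LowerFrame : Prop :=
  ∀ a b c : ℂ, (a ≠ 0 ∨ b ≠ 0 ∨ c ≠ 0) → ∀ N : ℕ, 3 ^ N ≤ Literature.Computability.AlgebraicComplexity.tensorRank (Literature.Computability.AlgebraicComplexity.kroneckerPow (fun x y z : Fin 3 => if x + y + z = 0 then ![a, b, c] (y - x) else (0 : ℂ)) N)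

/-- item stmt-MatrixMultiplication-4899 · support · rank 9 · closed · proved by Summit.MatrixMultiplication.MatrixMultiplication.Theorems.unitPoints_proof @ 0d3644d1b193 (prover) · by planner
sources: BremnerHuOeding2014, Nurmiev2000
[support] the twelve unit points: u(a,b,c) has rank ≤ 3 at the 3 coordinate points (a single X_i, a
relabelled ⟨3⟩) and at the 9 points a³ = b³ = c³ (u(1,1,1) = [x+y+z ≡ 0] = ⅓Σ_χ χ⊗χ⊗χ, and
u(1,ωⁱ,ωʲ) is its image under the diagonal torus generated by D, D′ — verified for all nine); these
are the 12 double points of the mirror arrangement and, with 0, exhaust {R ≤ 3} ∩ 𝔠 (converse via I₉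
and I₆³ : I₁₂, not filed). [difficulty: provable-now] -/
@[route_item "route-MatrixMultiplication-HessianPlane"]
def UnitPoints : Prop :=
  ∀ a b c : ℂ, ((b = 0 ∧ c = 0) ∨ (a = 0 ∧ c = 0) ∨ (a = 0 ∧ b = 0) ∨ (a ^ 3 = b ^ 3 ∧ b ^ 3 = c ^ 3)) → Literature.Computability.AlgebraicComplexity.tensorRank (fun x y z : Fin 3 => if x + y + z = 0 then ![a, b, c] (y - x) else (0 : ℂ)) ≤ 3

/-- item stmt-MatrixMultiplication-8531 · support · rank 9 · closed · proved by Summit.MatrixMultiplication.MatrixMultiplication.Theorems.marginalsFlat_proof @ d0c8d461ed3e (prover) · by planner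
[support] flat marginals (replaces rev-0 QuantumFlat; route-repair 2026-08-15): for ALL (a,b,c) ∈ ℂ³
the three reduced density matrices of u(a,b,c) — flattening along factor 1, 2, 3 times its conjugate
transpose, written exactly in the shape of `reducedDensity₁/₂/₃` of
Literature/…/QuantumFunctionals.lean but over Mathlib matrices only — equal (|a|²+|b|²+|c|²)·I₃
(every slice of the support {x+y+z ≡ 0} is a permutation pattern carrying each weight a,b,c once;
verified exactly). Why it is here: (i) with the PROVED CVZ lemmas
`quantumEntropy_le_logQuantumFunctional` and `logQuantumFunctional_le` it gives F^θ(u(a,b,c)) = 3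
for every θ in the simplex and every (a,b,c) ≠ 0 (quantum entropy at the identity already equals the
dimension bound log₂3), i.e. every catalogued spectral lower bound is blind on the punctured plane
(card free theorem (i)) — a prover may derive that corollary in a Theorems file importing
QuantumFunctionals, the route file no longer does; (ii) the SL₃³ moment map vanishes at u, so u is a
minimal vector with closed orbit (Kempf–Ness): the plane is polystable, the reason
UnstableTensorBarrier does not apply. Proof: unfold Matrix.mul/conjTranspose, `Fin.sum_univ_three` -/
@[route_item "route-MatrixMultiplication-HessianPlane"]
def MarginalsFlat : Prop :=
  ∀ a b c : ℂ, (Matrix.of (fun (x : Fin 3) (p : Fin 3 × Fin 3) => (fun x y z : Fin 3 => if x + y + z = 0 then ![a, b, c] (y - x) else (0 : ℂ)) x p.1 p.2) * (Matrix.of (fun (x : Fin 3) (p : Fin 3 × Fin 3) => (fun x y z : Fin 3 => if x + y + z = 0 then ![a, b, c] (y - x) else (0 : ℂ)) x p.1 p.2))ᴴ = (((Complex.normSq a + Complex.normSq b + Complex.normSq c : ℝ) : ℂ) • (1 : Matrix (Fin 3) (Fin 3) ℂ))) ∧ (Matrix.of (fun (y : Fin 3) (p : Fin 3 × Fin 3)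 => (fun x y z : Fin 3 => if x + y + z = 0 then ![a, b, c] (y - x) else (0 : ℂ)) p.1 y p.2) * (Matrix.of (fun (y : Fin 3) (p : Fin 3 × Fin 3) => (fun x y z : Fin 3 => if x + y + z = 0 then ![a, b, c] (y - x) else (0 : ℂ)) p.1 y p.2))ᴴ = (((Complex.normSq a + Complex.normSq b + Complex.normSq c : ℝ) : ℂ) • (1 : Matrix (Fin 3) (Fin 3) ℂ))) ∧ (Matrix.of (fun (z : Fin 3) (p : Fin 3 × Fin 3) => (fun x y z : Fin 3 => if x + y + z = 0 then ![a, b, c] (y - x) else (0 : ℂ)) p.1 p.2 z) * (Matrix.of (fun (z : Fin 3) (p : Fin 3 × Fin 3) => (fun x y z : Fin 3 => if x + y + z = 0 then ![a, b, c] (y - x) else (0 : ℂ)) p.1 p.2 z))ᴴ = (((Complex.normSq a + Complex.normSq b + Complex.normSq c : ℝ) : ℂ) • (1 : Matrix (Fin 3) (Fin 3) ℂ)))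

/-- item stmt-MatrixMultiplication-4900 · assembly · rank 1 · closed · proved by Summit.MatrixMultiplication.MatrixMultiplication.Theorems.hessianPlane_assembly_proof (prover) · by planner
sources: CoppersmithWinograd1990, ConnerGesmundoLandsbergVentura2022, BurgisserClausenShokrollahi1997, AlmanLi2026
[assembly] HessianPlaneFlat → MatrixMultiplication (via the CW point (0,1,1) and the proved
asymptotic-rank form of Coppersmith–Winograd 1990). -/
@[route_item "route-MatrixMultiplication-HessianPlane"]
def Assembly : Prop :=
  HessianPlaneFlat → MatrixMultiplication

/-! D-0027 §2.1 — DECIDING THEOREM (planner-authored via `route open/edit --closes-file`; by planner-rbadge-MatrixMultiplication-HessianPla-f392c9b7-g2-0 2026-08-15T16:16:40Z):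
its hypotheses are this route's items and its conclusion the sub-problem Statement (glue_lint), and it elaborates with this file. -/

/-- Deciding theorem (D-0027 §2.1). The route's target `HessianPlaneFlat` (asymptotic rank ≤ 3 on
the whole Hessian plane) is specialised by the support item `HesseToCW` to the CW point
`(a,b,c) = (0,1,1)`, i.e. to the asymptotic-rank-3 statement for `T_cw,2` (BThesis of route
AsymptoticRankCW, body inlined), and the support item `CWPointAssembly` (provable now from the
PROVED fact `CoppersmithWinograd1990_asymptoticRank_form_holds` + `omega_ge_two`) carries that to
`ω(ℂ) = 2`. The glue itself is composition. -/
@[closes "route-MatrixMultiplication-HessianPlane"] theorem closes (h₁ : HessianPlaneFlat) (h₂ : HesseToCW) (h₃ : CWPointAssembly) :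
    MatrixMultiplication :=
  h₃ (h₂ h₁)

end Summit.MatrixMultiplication.MatrixMultiplication.Theses.HessianPlane
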